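/-
Copyright: lit-balaban Phase-2 proof seat p30 (gen 29).  Statement-level skeleton of a published paper; no proof claims beyond what
the kernel checks below.
-/
import Literature.MathematicalPhysics.QuantumFieldTheory.BalabanImbrieJaffe1984to88.BIJ88NeumannPropagatorSmallFieldCloseRegion
import Literature.MathematicalPhysics.QuantumFieldTheory.BalabanImbrieJaffe1984to88.BIJ88NeumannPropagatorSmallFieldCloseHolder
import Literature.MathematicalPhysics.QuantumFieldTheory.BalabanImbrieJaffe1984to88.BIJ88NeumannPropagatorActualBackground

/-!
# [BalabanImbrieJaffe1985] §7.3 p. 326 ⟵ [Balaban1983RegularityDecay] Theorem p. 573, (1.10)–(1.12): **THE `δG_k(□, Ω)` MEMBERS AT THE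
# ACTUAL BACKGROUND `u_k = u_k(e_k, v)` OF (4.5.4) UNDER THE PRINTED (7.3.1), HYPOTHESIS-FREE** — the (1.11)–(1.12) value member (every row),
# the covariant-derivative member (rows whose open `L^k`-ball lies in `□`), p27's Hölder (1.9)-shape member (pairs `17L^k`-deep), the
# packaged (H1.10″) inputs and p31's consumer shape `hC`, for
# GENERAL NESTED `k`-BLOCK UNIONS `□ ⊆ Ω` and for (torus cube, whole torus), at `U := actualBgU1 hd2 k e v` with ONE threshold
# `e_k𝓅(e_k) ≤ c₁(d, L)` for all tori, scales and regions (p34 gen 19's passage `smallPlaquette_actualBg` BY NAME).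

T. Bałaban, J. Imbrie, A. Jaffe, *Renormalization of the Higgs model: minimizers, propagators and the stability of mean field theory*,
Commun. Math. Phys. **97** (1985) 299–329 [BalabanImbrieJaffe1985] = [I], §7.3 p. 326 [PDF 28], (4.5.4) p. 313 [PDF 15]; T. Bałaban,
*Regularity and decay of lattice Green's functions*, Commun. Math. Phys. **89** (1983) 571–597 [Balaban1983RegularityDecay] = [7] of [I],
Theorem p. 573 [PDF 3], (1.10)–(1.12); T. Bałaban, J. Imbrie, A. Jaffe, *Effective action and cluster properties of the abelian Higgs
model*, Commun. Math. Phys. **114** (1988) 257–315 [BalabanImbrieJaffe1988], Sect. 2 p. 263 [PDF 7], (2.27)/(2.31).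

statement-level skeleton of published theorems with citation tags; proofs where landed; nothing here is a claim about the Yang–Mills mass gap

PDF held: `paper:balaban1985-cmp97-bij-higgs-minimizers` (journal page = PDF page + 298), p. 326 [PDF 28];
`paper:balaban1983-cmp89-regularity-decay` (journal page = PDF page + 570), p. 573 [PDF 3];
`paper:balaban1988-cmp114-bij-abelian-higgs-effective-action` (journal page = PDF page + 256), p. 263 [PDF 7].

CITATION HEADER (lean-in-tree rule).  Part of the lit-balaban TYPED SKELETON (HOME `run/shared/lean/pub/lit-balaban/`), PHASE-2 proof
seat p30 gen 29 (unit `lit-balaban-p30-g29`; free-target protocol G.5-34(d), own lineage gens 25–29; TAKING line HOME/STATUS.md; p34 gen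
19's offer 2026-08-23T08:30:50Z «Your general nested-region members (`…CloseRegion`, `…CloseAllRows`) stay yours — file 1's
`plaqSmall_actualBg_of_hyp731` + `smallness_pack` is the 3-line passage if you want them at u_k»).  WHAT IS REPRODUCED: located MEMBERS of
rows **C1.Eq7.3.1-7.3.2** (owner r15; [I] p. 326 «also satisfy the regularity and decay estimates of [7]») and **C2.Eq2.31** /
**C2.Claim@263** / **C2.Eq2.27** (owner r18): the (1.11)–(1.12) `δG` members of gens 27–29, whose only remaining hypothesis was the
block-scale fine-plaquette smallness `‖u(∂p) − 1‖ ≤ θ`, `((L^k)²θ)² ≤ 1/500`, are stated AT THE BACKGROUNDS OF RECORD `u_k(e_k, v)` under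
the printed unit-lattice hypothesis (7.3.1) on `v` and one threshold on `e_k𝓅(e_k)`.  No row is restated and no head changes.
USED BY NAME: p34 gen 19's `BIJ88NeumannPropagatorActualBackground.smallPlaquette_actualBg` (front (δ): (7.3.1) ⇒ every fine plaquette of
`u_k` within `θ = K·e𝓅(e)/(L^k)²` of `1`, `K = (π/2)K_R(d, L)` from p33's `BIJ85Claim73AllTori.exists_KR_allTori`, and the threshold
arithmetic `((L^k)²θ)² ≤ 1/500` under `e𝓅(e) ≤ 1/(23D²K)`); p33's `BIJ85Eq454PlaqResidual.actualBgU1` (the background (4.5.4) on the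
tree's `GaugeField` carrier); gen 29's own `BIJ88NeumannPropagatorSmallFieldCloseRegion.inputs110_smallPlaquette_region` /
`close112_smallPlaquette_region` / `close112_smallPlaquette_region_deriv` / `close112_smallPlaquette_region_hC` (p358281) and
`BIJ88NeumannPropagatorSmallFieldCloseAllRows.close112_smallPlaquette_cube_torus_allRows` / `close112_smallPlaquette_cube_torus_deriv_ballRows`
(p357955); p27 g37's `BIJ88NeumannPropagatorSmallFieldCloseHolder.closeHolder112_smallField_of_inputs110` / `closeHolder112_smallField_input110`
(p356227) and p30 gen 26's `stairHol`; p31's `gBox`, `IsBlockUnion`, `cubeT`.  Kind: theorems only (no definition, no `Prop`-valued fact).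

THE PRINTED TEXT, verbatim.  [I] p. 326 [PDF 28]: *"In particular, let us assume that for the unit lattice field v, |v(∂p) − 1| ≦ e_k𝓅(e_k),
(7.3.1) where 𝓅(e_k) = (1 + ln e_k^{−1})^𝓅. … The propagators arising from Δ_k(u_k), under the restriction (7.3.1) on the gauge field,
also satisfy the regularity and decay estimates of [7]."*  [7] p. 573 [PDF 3]: *"If Ω ⊂ Ω₀, then for δG_k(Ω, Ω₀, A) defined by the equality
δG_k(Ω, Ω₀, A) = G_k(Ω, A) − G_k(Ω₀, A), (1.11) we have the inequalities (1.5) and (1.6) (with the same restrictions on x, x′) with the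
additional factor exp(−δ₀ dist(x, Ω^c) − δ₀ dist(supp f, Ω^c)) (1.12) on the right hand sides. For some simple sets Ω, e.g. for rectangular
parallelepipeds, the inequalities hold without any restrictions on the points x, x′, i.e. for all x, x′ ∈ Ω."*  [BalabanImbrieJaffe1988]
p. 263 [PDF 7], lines 16–20, verbatim: *"[Each G_k(□_α, u) is close to G_k(Ω, u) for the relevant x₁, x₂, therefore the convex combination
and G_{k,loc} are close also.] We assume that u is smooth in the □_α's entering the sum in (2.27); for (2.31) we assume smoothness throughout
the subset Ω ⊂ T_η."*  READING (ours, NOT a quotation): `Ω` = a union of `k`-blocks of the torus containing the cubes `□_α` of (2.27) — the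
tree's `IsBlockUnion k Ω` with `□_α ⊆ Ω`.  v1.0.1 (DOCSTRING-ONLY; referee-5 g70 finding D-g70-2 pattern served here too): v1.0 presented
this reading inside the quotation; only verbatim text is now quoted.  Lean declarations unchanged (byte-identical bodies).

THE ARGUMENT (one line per member).  p34's `smallPlaquette_actualBg` gives, for `d + 1 ≥ 2`, `L = ℓ + 1`, `𝓅`, a constant `K ≥ 1` such
that under (7.3.1) and `e𝓅(e) ≤ 1/(23D²K)` the number `θ = K·e𝓅(e)/(L^k)²` is `≥ 0`, bounds `‖plaqC u_k x μ ν − 1‖` at every fine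
plaquette and satisfies `((L^k)²θ)² ≤ 1/500`; these are exactly the three field hypotheses of the six small-plaquette theorems of gens 29
(`…CloseRegion`, `…CloseAllRows`), which are applied verbatim at `U := actualBgU1 hd2 k e v`.

WHAT IS PROVED (0 `sorry`; standard axioms; theorems only; every constant from `(d, ℓ, a, 𝓅)` only, ONE threshold `c₁ = 1/(23D²K(D, L))`).
* §1 **`inputs110_actualBg_region`** — the side condition `2D³((L^k)²θ)² ≤ 1` and the four (H1.10″) members (hGB)/(hGΩ)/(hDB)/(hDΩ) of
  gen 28's `close112_smallField_deriv_of_inputs`, for all nested `k`-block unions `□ ⊆ Ω`, AT `u_k` (`θ = K·e𝓅(e)/(L^k)²` displayed).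
* §2 **`close112_actualBg_region`** — `‖(G_k(□,u_k)f)(x) − (G_k(Ω,u_k)f)(x)‖ ≤ (L^kε)²·c e^{−δD/L^k}e^{−δ(D_b+D_f)/L^k}·F` at EVERY row
  `x ∈ □`, `f` supported in `□`, all nested `k`-block unions `□ ⊆ Ω`; **`close112_actualBg_region_deriv`** — the same for
  `covD ε⁻¹ u_k (G_k(□,u_k)f) − covD ε⁻¹ u_k (G_k(Ω,u_k)f)` at the bonds from rows with `L^k ≤ dist_∞(x, T∖□)`, factor `(L^kε)`;
  **`close112_actualBg_region_hC`** — p31's `opClose231_gen` binders (hGΩ) (every row) and (hC) (every row of every `□_α ⊆ Ω`) AT `u_k`.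
* §3 **`close112_actualBg_cube_torus_allRows`** / **`close112_actualBg_cube_torus_deriv_ballRows`** — the (□, Ω) = (torus cube
  `cubeT (L^k) c (L^kM)`, whole torus) members AT `u_k`, value at every row, covariant derivative at rows `≥ L^k` deep.
* §4 **`closeHolder112_actualBg_region`** / **`closeHolder112_actualBg_region_input`** — p27 g37's HÖLDER (order `1+α`, `0 ≤ α < 1`) member of
  the clause (`closeHolder112_smallField_of_inputs110` / `_input110`, p356227) AT `u_k`, its four (H1.10″) inputs discharged by §1: pairs of
  distinct rows of `□` both `17L^k`-deep, `(L^k/T(x₀,x₁))^α‖U(Γ)(D_{u_k}w)(x₁,μ) − (D_{u_k}w)(x₀,μ)‖ ≤ (L^kε)·c₃e^{−δ₃D/L^k}e^{−δ₃(D_b+D_f)/L^k}F`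
  (included at p27's offer 2026-08-23T08:45:25Z so that the `u_k` table sits in one file).
HONEST SCOPE.  (i) `U(1)` only; `D = d + 1 ∈ {2, 3}`; `L = ℓ + 1` odd, `ℓ ≥ 1`; `1 ≤ k ≤ K` (the members' range) with `2(L^k − 1) + 4 < |T|`;
couplings `0 < e ≤ 1` with `e𝓅(e) ≤ c₁` («for e(ε) sufficiently small»: `c₁ = 1/(23D²K)`, `K = (π/2)K_R(D, L)` — p33's all-tori residual
constant, existential, not evaluated); (7.3.1) on ALL unit plaquettes of `T^{(k)}` as printed.  (ii) The conclusions are those of the gen-29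
members verbatim (their scope notes apply: centred block averages, Neumann bonds, p31's `gBox` with `a = α_kL^{kD}`, `c = ε⁻¹`; covariant
derivative only at rows whose open `L^k`-ball lies in `□` — [7]'s `R₀`; method divergence from [7]'s random-walk expansion disclosed
there; Hölder member at pairs both `17L^k`-deep, p27's depth).  (iii) The identification of `gBox … univ` / `gBox … Ω` at `u_k` with [I]'s `G_k(u_k)` of (4.6.2) is p33's lane
(`BIJ85Claim73PropagatorDecay`), not addressed here; [7]'s Theorem INCLUDING its (1.11)–(1.12) members for [7]'s OWN box-carrier
propagators at `u_k` on local regions (smooth gauge, p17's `ThmPrintedNN` family) is p33 gen 12's `BIJ85RegionPropagatorsActualBgMembers` /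
`BIJ85RegionPropagatorsActualBgThm.thmPrintedNN_actualBgFam` — a different object; the present file states the members for the TORUS
propagators of record `gBox` consumed by the [BalabanImbrieJaffe1988] §2 chains (p31/p29/p27).  Literature + Mathlib only.  Unit `lit-balaban-p30`
(literature-prover-lit-balaban-p30-g29-0), 2026-08-23.  NOT summit progress.
-/

open scoped BigOperators ComplexConjugate
open Finset Matrix

namespace Literature.MathematicalPhysics.QuantumFieldTheory.BalabanImbrieJaffe1984to88.BIJ88NeumannPropagatorActualBackgroundRegion

open Literature.MathematicalPhysics.QuantumFieldTheory.Balaban1983to89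
open BIJ88Sect3Statements (U1 toC cfg covD)
open BIJ85Sect1Model (U1Field plaq)
open BIJ85AbelianStokes (plaqC)
open BIJ85Eq454PlaqResidual (actualBgU1)
open BIJ88NeumannNoZeroModesTorus (IsBlockUnion)
open BIJ88NeumannPropagator227Torus (gBox)
open BIJ88NeumannPropagatorFlatDecayCube (cubeT)
open BIJ88NeumannPropagatorActualBackground (smallPlaquette_actualBg)
open BIJ88NeumannPropagatorSmallFieldCloseRegion (inputs110_smallPlaquette_region close112_smallPlaquette_region
  close112_smallPlaquette_region_deriv close112_smallPlaquette_region_hC)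
open BIJ88NeumannPropagatorSmallFieldCloseAllRows (close112_smallPlaquette_cube_torus_allRows
  close112_smallPlaquette_cube_torus_deriv_ballRows)
open BIJ85ScalarPropagatorHolderDecay (stairHol)
open BIJ88NeumannPropagatorSmallFieldCloseHolder (closeHolder112_smallField_of_inputs110 closeHolder112_smallField_input110)

noncomputable section

/-- kernel: `(P.d : ℝ) = d + 1` when `P.d = d + 1`. [cite: BalabanImbrieJaffe1985, (2.1) p.302] -/
private theorem cast_d_eq {P : Params} {d : ℕ} (hPd : P.d = d + 1) : (P.d : ℝ) = (d : ℝ) + 1 := by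
  rw [hPd]; push_cast; ring

/-! ## §1 The packaged (H1.10″) inputs for nested block unions at the actual background -/

/-- **THE FOUR (H1.10″) INPUTS OF THE (1.11)–(1.12) CLAUSE FOR GENERAL NESTED `k`-BLOCK UNIONS `□ ⊆ Ω` AT THE ACTUAL BACKGROUND
`u_k(e_k, v)` UNDER THE PRINTED (7.3.1)** (gen 29's `inputs110_smallPlaquette_region` ∘ p34's `smallPlaquette_actualBg`): for `1 ≤ d`,
`d + 1 ≤ 3`, `ℓ ≥ 1` with `ℓ + 1` odd, `a > 0`, `𝓅` there are `c₁ > 0`, `K ≥ 1`, `c₀ ≥ 0`, `δ₀ > 0` such that for every volume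
(`P.d = d + 1`, `P.L = ℓ + 1`), every `1 ≤ k ≤ K` with `2(L^k − 1) + 4 < |T|`, every coupling `0 < e ≤ 1` with `e𝓅(e) ≤ c₁`, every unit
field `v` with `‖v(∂q) − 1‖ ≤ e𝓅(e)` for all `q` (7.3.1), and all nested `k`-block unions `□ ⊆ Ω`, writing `u_k = actualBgU1 hd2 k e v` and
`θ = K·e𝓅(e)/(L^k)²`: `0 ≤ θ`, `‖u_k(∂p) − 1‖ ≤ θ` at every fine plaquette, `((L^k)²θ)² ≤ 1/500`, `2D³((L^k)²θ)² ≤ 1`, and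
(hGB) `‖(G_k(□,u_k)f)(x)‖ ≤ (L^kε)²c₀e^{−δ₀D/L^k}F`, (hGΩ) the same for `G_k(Ω,u_k)`, at every `x ∈ □`; (hDB)
`‖covD ε⁻¹ u_k (G_k(□,u_k)f)⟨x,μ⟩‖ ≤ (L^kε)c₀e^{−δ₀D/L^k}F`, (hDΩ) the same for `G_k(Ω,u_k)`, at every `x` with `{T(x,·) < L^k} ⊆ □`.
[cite: BalabanImbrieJaffe1985, (7.3.1) p.326 «also satisfy the regularity and decay estimates of [7]»]
[cite: Balaban1983RegularityDecay, Theorem p.573 (1.10)] -/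
theorem inputs110_actualBg_region (d ℓ : ℕ) (hd1 : 1 ≤ d) (hd3 : d + 1 ≤ 3) (hℓ : 1 ≤ ℓ) (hodd : Odd (ℓ + 1)) {a : ℝ} (ha : 0 < a)
    (pexp : ℝ) :
    ∃ c₁ K c₀ δ₀ : ℝ, 0 < c₁ ∧ 1 ≤ K ∧ 0 ≤ c₀ ∧ 0 < δ₀ ∧ ∀ (P : Params) (hPd : P.d = d + 1), P.L = ℓ + 1 →
      ∀ (hd2 : 2 ≤ P.d) (k : ℕ), 1 ≤ k → k ≤ P.K → 2 * (P.L ^ k - 1) + 4 < P.sitesPerDir 0 →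
      ∀ (e : ℝ), 0 < e → e ≤ 1 → e * (1 + Real.log e⁻¹) ^ pexp ≤ c₁ →
      ∀ (v : U1Field P k), (∀ q : Balaban1983to89.Plaq P k, ‖((plaq v q : Circle) : ℂ) - 1‖ ≤ e * (1 + Real.log e⁻¹) ^ pexp) →
      ∀ (B Ω : Finset (Balaban1983to89.Site P 0)), IsBlockUnion k B → IsBlockUnion k Ω → B ⊆ Ω →
      0 ≤ K * (e * (1 + Real.log e⁻¹) ^ pexp) / ((P.L : ℝ) ^ k) ^ 2 ∧
      (∀ (y : Balaban1983to89.Site P 0) (μ ν : Fin P.d),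
          ‖plaqC (actualBgU1 hd2 k e v) y μ ν - 1‖ ≤ K * (e * (1 + Real.log e⁻¹) ^ pexp) / ((P.L : ℝ) ^ k) ^ 2) ∧
      (((P.L : ℝ) ^ k) ^ 2 * (K * (e * (1 + Real.log e⁻¹) ^ pexp) / ((P.L : ℝ) ^ k) ^ 2)) ^ 2 ≤ 1 / 500 ∧
      2 * (P.d : ℝ) ^ 3 * (((P.L : ℝ) ^ k) ^ 2 * (K * (e * (1 + Real.log e⁻¹) ^ pexp) / ((P.L : ℝ) ^ k) ^ 2)) ^ 2 ≤ 1 ∧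
      (∀ x ∈ B, ∀ (f : Balaban1983to89.Site P 0 → ℂ) (F D : ℝ), (∀ y, ‖f y‖ ≤ F) → 0 ≤ D →
          (∀ y, f y ≠ 0 → D ≤ B5Ineq137Torus.T P 0 x y) →
          ‖(gBox (B1RG242Torus.α P a k * (P.L : ℝ) ^ (k * P.d)) P.eps⁻¹ (actualBgU1 hd2 k e v) k B *ᵥ f) x‖ ≤
            P.spacing k ^ 2 * (c₀ * Real.exp (-(δ₀ * (((P.L : ℝ) ^ k)⁻¹ * D))) * F)) ∧
      (∀ x ∈ B, ∀ (f : Balaban1983to89.Site P 0 → ℂ) (F D : ℝ), (∀ y, ‖f y‖ ≤ F) → 0 ≤ D →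
          (∀ y, f y ≠ 0 → D ≤ B5Ineq137Torus.T P 0 x y) →
          ‖(gBox (B1RG242Torus.α P a k * (P.L : ℝ) ^ (k * P.d)) P.eps⁻¹ (actualBgU1 hd2 k e v) k Ω *ᵥ f) x‖ ≤
            P.spacing k ^ 2 * (c₀ * Real.exp (-(δ₀ * (((P.L : ℝ) ^ k)⁻¹ * D))) * F)) ∧
      (∀ x, (∀ y, B5Ineq137Torus.T P 0 x y < (P.L : ℝ) ^ k → y ∈ B) →
          ∀ (f : Balaban1983to89.Site P 0 → ℂ) (F D : ℝ), (∀ y, ‖f y‖ ≤ F) → 0 ≤ D →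
          (∀ y, f y ≠ 0 → D ≤ B5Ineq137Torus.T P 0 x y) → ∀ (μ : Fin P.d),
          ‖covD P.eps⁻¹ (cfg (actualBgU1 hd2 k e v))
              (gBox (B1RG242Torus.α P a k * (P.L : ℝ) ^ (k * P.d)) P.eps⁻¹ (actualBgU1 hd2 k e v) k B *ᵥ f) ⟨x, μ⟩‖ ≤
            P.spacing k * (c₀ * Real.exp (-(δ₀ * (((P.L : ℝ) ^ k)⁻¹ * D))) * F)) ∧
      (∀ x, (∀ y, B5Ineq137Torus.T P 0 x y < (P.L : ℝ) ^ k → y ∈ B) →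
          ∀ (f : Balaban1983to89.Site P 0 → ℂ) (F D : ℝ), (∀ y, ‖f y‖ ≤ F) → 0 ≤ D →
          (∀ y, f y ≠ 0 → D ≤ B5Ineq137Torus.T P 0 x y) → ∀ (μ : Fin P.d),
          ‖covD P.eps⁻¹ (cfg (actualBgU1 hd2 k e v))
              (gBox (B1RG242Torus.α P a k * (P.L : ℝ) ^ (k * P.d)) P.eps⁻¹ (actualBgU1 hd2 k e v) k Ω *ᵥ f) ⟨x, μ⟩‖ ≤
            P.spacing k * (c₀ * Real.exp (-(δ₀ * (((P.L : ℝ) ^ k)⁻¹ * D))) * F)) := by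
  obtain ⟨K, hK1, HK⟩ := smallPlaquette_actualBg (d := d + 1) (L := ℓ + 1) (by omega) pexp
  obtain ⟨c₀, δ₀, hc₀, hδ₀, HI⟩ := inputs110_smallPlaquette_region d ℓ hd1 hd3 hℓ hodd ha
  refine ⟨1 / (23 * ((d : ℝ) + 1) ^ 2 * K), K, c₀, δ₀, by positivity, hK1, hc₀, hδ₀, ?_⟩
  intro P hPd hPL hd2 k hk1 hkK hbig e he he1 hsm v hv B Ω hB hΩ hsub
  rw [← cast_d_eq hPd] at hsm
  obtain ⟨hθ0, hplaq, -, hsm1, -, -, hτ⟩ := HK P hPd hPL hd2 k hk1 (hkK.trans (Nat.le_add_left _ _)) e he he1 hsm v hv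
  obtain ⟨-, hGB, hGΩ, hDB, hDΩ⟩ := HI P hPd hPL k hk1 hkK hbig (actualBgU1 hd2 k e v) _ hθ0 hplaq hτ B Ω hB hΩ hsub
  exact ⟨hθ0, hplaq, hτ, hsm1, hGB, hGΩ, hDB, hDΩ⟩

/-! ## §2 The `δG_k(□, Ω)` members for nested block unions at the actual background -/

/-- **[Balaban1983RegularityDecay] (1.11)–(1.12), VALUE MEMBER, FOR GENERAL NESTED `k`-BLOCK UNIONS `□ ⊆ Ω` AT THE ACTUAL BACKGROUND
`u_k(e_k, v)` UNDER THE PRINTED (7.3.1), AT EVERY ROW `x ∈ □`** (gen 29's `close112_smallPlaquette_region` ∘ p34's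
`smallPlaquette_actualBg`): for `1 ≤ d`, `d + 1 ≤ 3`, `ℓ ≥ 1` with `ℓ + 1` odd, `a > 0`, `𝓅` there are `c₁, c, δ > 0` such that for every
volume (`P.d = d + 1`, `P.L = ℓ + 1`), every `1 ≤ k ≤ K` with `2(L^k − 1) + 4 < |T|`, every `0 < e ≤ 1` with `e𝓅(e) ≤ c₁`, every unit field
`v` with (7.3.1), all nested `k`-block unions `□ ⊆ Ω`, EVERY row `x ∈ □` and every `f` supported in `□` (`‖f‖_∞ ≤ F`, `D ≤ dist(x, supp f)`,
`D_b ≤ dist(x, □^c)`, `D_f ≤ dist(supp f, □^c)`), with `u_k = actualBgU1 hd2 k e v`: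
`‖(G_k(□,u_k)f)(x) − (G_k(Ω,u_k)f)(x)‖ ≤ (L^kε)²·c e^{−δD/L^k}e^{−δ(D_b + D_f)/L^k}·F`.
[cite: Balaban1983RegularityDecay, Theorem p.573 (1.11)–(1.12)] [cite: BalabanImbrieJaffe1985, (7.3.1) p.326, (4.5.4) p.313] -/
theorem close112_actualBg_region (d ℓ : ℕ) (hd1 : 1 ≤ d) (hd3 : d + 1 ≤ 3) (hℓ : 1 ≤ ℓ) (hodd : Odd (ℓ + 1)) {a : ℝ} (ha : 0 < a)
    (pexp : ℝ) :
    ∃ c₁ c δ : ℝ, 0 < c₁ ∧ 0 < c ∧ 0 < δ ∧ ∀ (P : Params) (hPd : P.d = d + 1), P.L = ℓ + 1 →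
      ∀ (hd2 : 2 ≤ P.d) (k : ℕ), 1 ≤ k → k ≤ P.K → 2 * (P.L ^ k - 1) + 4 < P.sitesPerDir 0 →
      ∀ (e : ℝ), 0 < e → e ≤ 1 → e * (1 + Real.log e⁻¹) ^ pexp ≤ c₁ →
      ∀ (v : U1Field P k), (∀ q : Balaban1983to89.Plaq P k, ‖((plaq v q : Circle) : ℂ) - 1‖ ≤ e * (1 + Real.log e⁻¹) ^ pexp) →
      ∀ (B Ω : Finset (Balaban1983to89.Site P 0)), IsBlockUnion k B → IsBlockUnion k Ω → B ⊆ Ω →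
      ∀ x ∈ B, ∀ (f : Balaban1983to89.Site P 0 → ℂ) (F D Db Df : ℝ), (∀ y, ‖f y‖ ≤ F) → (∀ y, y ∉ B → f y = 0) →
        0 ≤ D → (∀ y, f y ≠ 0 → D ≤ B5Ineq137Torus.T P 0 x y) → 0 ≤ Db → (∀ w, w ∉ B → Db ≤ B5Ineq137Torus.T P 0 x w) →
        0 ≤ Df → (∀ y, f y ≠ 0 → ∀ w, w ∉ B → Df ≤ B5Ineq137Torus.T P 0 y w) →
        ‖(gBox (B1RG242Torus.α P a k * (P.L : ℝ) ^ (k * P.d)) P.eps⁻¹ (actualBgU1 hd2 k e v) k B *ᵥ f) x -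
            (gBox (B1RG242Torus.α P a k * (P.L : ℝ) ^ (k * P.d)) P.eps⁻¹ (actualBgU1 hd2 k e v) k Ω *ᵥ f) x‖ ≤
          P.spacing k ^ 2 * (c * Real.exp (-(δ * (((P.L : ℝ) ^ k)⁻¹ * D))) *
            Real.exp (-(δ * (((P.L : ℝ) ^ k)⁻¹ * (Db + Df)))) * F) := by
  obtain ⟨K, hK1, HK⟩ := smallPlaquette_actualBg (d := d + 1) (L := ℓ + 1) (by omega) pexp
  obtain ⟨c, δ, hc, hδ, HC⟩ := close112_smallPlaquette_region d ℓ hd1 hd3 hℓ hodd ha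
  refine ⟨1 / (23 * ((d : ℝ) + 1) ^ 2 * K), c, δ, by positivity, hc, hδ, ?_⟩
  intro P hPd hPL hd2 k hk1 hkK hbig e he he1 hsm v hv B Ω hB hΩ hsub x hx f F D Db Df hF hfB hD hsD hDb hsDb hDf hsDf
  rw [← cast_d_eq hPd] at hsm
  obtain ⟨hθ0, hplaq, -, -, -, -, hτ⟩ := HK P hPd hPL hd2 k hk1 (hkK.trans (Nat.le_add_left _ _)) e he he1 hsm v hv
  exact HC P hPd hPL k hk1 hkK hbig (actualBgU1 hd2 k e v) _ hθ0 hplaq hτ B Ω hB hΩ hsub x hx f F D Db Df hF hfB hD hsD hDb hsDb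
    hDf hsDf

/-- **[Balaban1983RegularityDecay] (1.11)–(1.12), COVARIANT-DERIVATIVE MEMBER, FOR GENERAL NESTED `k`-BLOCK UNIONS `□ ⊆ Ω` AT THE ACTUAL
BACKGROUND `u_k(e_k, v)` UNDER THE PRINTED (7.3.1)** (gen 29's `close112_smallPlaquette_region_deriv` ∘ p34's `smallPlaquette_actualBg`):
same data as `close112_actualBg_region`, rows `x ∈ □` with `L^k ≤ T(x, w)` for every `w ∉ □` ([7]'s `dist(x, Ω^c) ≥ R₀`), every `μ`:
`‖covD ε⁻¹ u_k (G_k(□,u_k)f) ⟨x,μ⟩ − covD ε⁻¹ u_k (G_k(Ω,u_k)f) ⟨x,μ⟩‖ ≤ (L^kε)·c e^{−δD/L^k}e^{−δ(D_b + D_f)/L^k}·F`.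
[cite: Balaban1983RegularityDecay, Theorem p.573 (1.10)–(1.12)] [cite: BalabanImbrieJaffe1985, (7.3.1) p.326, (4.5.4) p.313] -/
theorem close112_actualBg_region_deriv (d ℓ : ℕ) (hd1 : 1 ≤ d) (hd3 : d + 1 ≤ 3) (hℓ : 1 ≤ ℓ) (hodd : Odd (ℓ + 1)) {a : ℝ}
    (ha : 0 < a) (pexp : ℝ) :
    ∃ c₁ c δ : ℝ, 0 < c₁ ∧ 0 < c ∧ 0 < δ ∧ ∀ (P : Params) (hPd : P.d = d + 1), P.L = ℓ + 1 →
      ∀ (hd2 : 2 ≤ P.d) (k : ℕ), 1 ≤ k → k ≤ P.K → 2 * (P.L ^ k - 1) + 4 < P.sitesPerDir 0 →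
      ∀ (e : ℝ), 0 < e → e ≤ 1 → e * (1 + Real.log e⁻¹) ^ pexp ≤ c₁ →
      ∀ (v : U1Field P k), (∀ q : Balaban1983to89.Plaq P k, ‖((plaq v q : Circle) : ℂ) - 1‖ ≤ e * (1 + Real.log e⁻¹) ^ pexp) →
      ∀ (B Ω : Finset (Balaban1983to89.Site P 0)), IsBlockUnion k B → IsBlockUnion k Ω → B ⊆ Ω →
      ∀ x ∈ B, (∀ w, w ∉ B → (P.L : ℝ) ^ k ≤ B5Ineq137Torus.T P 0 x w) →
      ∀ (f : Balaban1983to89.Site P 0 → ℂ) (F D Db Df : ℝ), (∀ y, ‖f y‖ ≤ F) → (∀ y, y ∉ B → f y = 0) →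
        0 ≤ D → (∀ y, f y ≠ 0 → D ≤ B5Ineq137Torus.T P 0 x y) → 0 ≤ Db → (∀ w, w ∉ B → Db ≤ B5Ineq137Torus.T P 0 x w) →
        0 ≤ Df → (∀ y, f y ≠ 0 → ∀ w, w ∉ B → Df ≤ B5Ineq137Torus.T P 0 y w) → ∀ (μ : Fin P.d),
        ‖covD P.eps⁻¹ (cfg (actualBgU1 hd2 k e v))
              (gBox (B1RG242Torus.α P a k * (P.L : ℝ) ^ (k * P.d)) P.eps⁻¹ (actualBgU1 hd2 k e v) k B *ᵥ f) ⟨x, μ⟩ -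
            covD P.eps⁻¹ (cfg (actualBgU1 hd2 k e v))
              (gBox (B1RG242Torus.α P a k * (P.L : ℝ) ^ (k * P.d)) P.eps⁻¹ (actualBgU1 hd2 k e v) k Ω *ᵥ f) ⟨x, μ⟩‖ ≤
          P.spacing k * (c * Real.exp (-(δ * (((P.L : ℝ) ^ k)⁻¹ * D))) *
            Real.exp (-(δ * (((P.L : ℝ) ^ k)⁻¹ * (Db + Df)))) * F) := by
  obtain ⟨K, hK1, HK⟩ := smallPlaquette_actualBg (d := d + 1) (L := ℓ + 1) (by omega) pexp
  obtain ⟨c, δ, hc, hδ, HC⟩ := close112_smallPlaquette_region_deriv d ℓ hd1 hd3 hℓ hodd ha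
  refine ⟨1 / (23 * ((d : ℝ) + 1) ^ 2 * K), c, δ, by positivity, hc, hδ, ?_⟩
  intro P hPd hPL hd2 k hk1 hkK hbig e he he1 hsm v hv B Ω hB hΩ hsub x hx hrow f F D Db Df hF hfB hD hsD hDb hsDb hDf hsDf μ
  rw [← cast_d_eq hPd] at hsm
  obtain ⟨hθ0, hplaq, -, -, -, -, hτ⟩ := HK P hPd hPL hd2 k hk1 (hkK.trans (Nat.le_add_left _ _)) e he he1 hsm v hv
  exact HC P hPd hPL k hk1 hkK hbig (actualBgU1 hd2 k e v) _ hθ0 hplaq hτ B Ω hB hΩ hsub x hx hrow f F D Db Df hF hfB hD hsD hDb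
    hsDb hDf hsDf μ

/-- **THE (H1.12″) AND (H1.10″) INPUTS OF p31's `BIJ88DeltaLocClose235General.opClose231_gen` FOR A GENERAL REGION `Ω` AT THE ACTUAL
BACKGROUND `u_k(e_k, v)` UNDER THE PRINTED (7.3.1)** (gen 29's `close112_smallPlaquette_region_hC` ∘ p34's `smallPlaquette_actualBg`):
for `1 ≤ d`, `d + 1 ≤ 3`, `ℓ ≥ 1` with `ℓ + 1` odd, `a > 0`, `𝓅` there are `c₁, c, δ > 0` such that for every volume, `1 ≤ k ≤ K`,
`2(L^k − 1) + 4 < |T|`, every `0 < e ≤ 1` with `e𝓅(e) ≤ c₁`, every `v` with (7.3.1), every `k`-block union `Ω` and every family of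
`k`-block unions `□_α ⊆ Ω` (our reading of p. 263 *"for (2.31) we assume smoothness throughout the subset Ω ⊂ T_η"*: `Ω` a union of
`k`-blocks containing the cubes `□_α` of (2.27)), with `u_k = actualBgU1 hd2 k e v`:
(hGΩ) `‖(G_k(Ω,u_k)f)(x)‖ ≤ (L^kε)²c e^{−δD/L^k}F` at every `x`, and (hC) at every row `x ∈ □_α`, `f` supported in `□_α`:
`‖(G_k(□_α,u_k)f)(x) − (G_k(Ω,u_k)f)(x)‖ ≤ (L^kε)²·c e^{−δD/L^k}e^{−δ(D_b + D_f)/L^k}·F`.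
[cite: Balaban1983RegularityDecay, Theorem p.573 (1.10)–(1.12)] [cite: BalabanImbrieJaffe1988, (2.31) p.263]
[cite: BalabanImbrieJaffe1985, (7.3.1) p.326] -/
theorem close112_actualBg_region_hC (d ℓ : ℕ) (hd1 : 1 ≤ d) (hd3 : d + 1 ≤ 3) (hℓ : 1 ≤ ℓ) (hodd : Odd (ℓ + 1)) {a : ℝ} (ha : 0 < a)
    (pexp : ℝ) :
    ∃ c₁ c δ : ℝ, 0 < c₁ ∧ 0 < c ∧ 0 < δ ∧ ∀ (P : Params) (hPd : P.d = d + 1), P.L = ℓ + 1 →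
      ∀ (hd2 : 2 ≤ P.d) (k : ℕ), 1 ≤ k → k ≤ P.K → 2 * (P.L ^ k - 1) + 4 < P.sitesPerDir 0 →
      ∀ (e : ℝ), 0 < e → e ≤ 1 → e * (1 + Real.log e⁻¹) ^ pexp ≤ c₁ →
      ∀ (v : U1Field P k), (∀ q : Balaban1983to89.Plaq P k, ‖((plaq v q : Circle) : ℂ) - 1‖ ≤ e * (1 + Real.log e⁻¹) ^ pexp) →
      ∀ (Ω : Finset (Balaban1983to89.Site P 0)) {ι : Type*} (cube : ι → Finset (Balaban1983to89.Site P 0)),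
      IsBlockUnion k Ω → (∀ α, IsBlockUnion k (cube α)) → (∀ α, cube α ⊆ Ω) →
      (∀ x ∈ (univ : Finset (Balaban1983to89.Site P 0)), ∀ (f : Balaban1983to89.Site P 0 → ℂ) (F D : ℝ), (∀ y, ‖f y‖ ≤ F) →
          0 ≤ D → (∀ y, f y ≠ 0 → D ≤ B5Ineq137Torus.T P 0 x y) →
          ‖(gBox (B1RG242Torus.α P a k * (P.L : ℝ) ^ (k * P.d)) P.eps⁻¹ (actualBgU1 hd2 k e v) k Ω *ᵥ f) x‖ ≤
            P.spacing k ^ 2 * (c * Real.exp (-(δ * (((P.L : ℝ) ^ k)⁻¹ * D))) * F)) ∧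
      (∀ α, ∀ x ∈ cube α, ∀ (f : Balaban1983to89.Site P 0 → ℂ) (F D Db Df : ℝ), (∀ y, ‖f y‖ ≤ F) →
        (∀ y, y ∉ cube α → f y = 0) → 0 ≤ D → (∀ y, f y ≠ 0 → D ≤ B5Ineq137Torus.T P 0 x y) → 0 ≤ Db →
        (∀ w, w ∉ cube α → Db ≤ B5Ineq137Torus.T P 0 x w) → 0 ≤ Df →
        (∀ y, f y ≠ 0 → ∀ w, w ∉ cube α → Df ≤ B5Ineq137Torus.T P 0 y w) →
        ‖(gBox (B1RG242Torus.α P a k * (P.L : ℝ) ^ (k * P.d)) P.eps⁻¹ (actualBgU1 hd2 k e v) k (cube α) *ᵥ f) x -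
            (gBox (B1RG242Torus.α P a k * (P.L : ℝ) ^ (k * P.d)) P.eps⁻¹ (actualBgU1 hd2 k e v) k Ω *ᵥ f) x‖ ≤
          P.spacing k ^ 2 * (c * Real.exp (-(δ * (((P.L : ℝ) ^ k)⁻¹ * D))) *
            Real.exp (-(δ * (((P.L : ℝ) ^ k)⁻¹ * (Db + Df)))) * F)) := by
  obtain ⟨K, hK1, HK⟩ := smallPlaquette_actualBg (d := d + 1) (L := ℓ + 1) (by omega) pexp
  obtain ⟨c, δ, hc, hδ, HC⟩ := close112_smallPlaquette_region_hC d ℓ hd1 hd3 hℓ hodd ha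
  refine ⟨1 / (23 * ((d : ℝ) + 1) ^ 2 * K), c, δ, by positivity, hc, hδ, ?_⟩
  intro P hPd hPL hd2 k hk1 hkK hbig e he he1 hsm v hv Ω ι cube hΩ hcube hsub
  rw [← cast_d_eq hPd] at hsm
  obtain ⟨hθ0, hplaq, -, -, -, -, hτ⟩ := HK P hPd hPL hd2 k hk1 (hkK.trans (Nat.le_add_left _ _)) e he he1 hsm v hv
  exact HC P hPd hPL k hk1 hkK hbig (actualBgU1 hd2 k e v) _ hθ0 hplaq hτ Ω cube hΩ hcube hsub

/-! ## §3 The (torus cube, whole torus) members at the actual background -/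

/-- **[Balaban1983RegularityDecay] (1.11)–(1.12), VALUE MEMBER, FOR A TORUS CUBE AGAINST THE WHOLE TORUS AT THE ACTUAL BACKGROUND
`u_k(e_k, v)` UNDER THE PRINTED (7.3.1), AT EVERY ROW `x ∈ □`** (gen 29's `close112_smallPlaquette_cube_torus_allRows` ∘ p34's
`smallPlaquette_actualBg`; p. 573: *"for rectangular parallelepipeds, the inequalities hold without any restrictions on the points x, x′"*):
for `1 ≤ d`, `d + 1 ≤ 3`, `ℓ ≥ 1` with `ℓ + 1` odd, `a > 0`, `𝓅` there are `c₁, c₃, δ₃ > 0` such that for every volume, `1 ≤ k ≤ K` with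
`2(L^k − 1) + 4 < |T|`, every `0 < e ≤ 1` with `e𝓅(e) ≤ c₁`, every `v` with (7.3.1), every cube `□ = cubeT (L^k) c (L^kM)` (`M_i ≥ 1`,
fitting, `L^kM_i < |T|`), EVERY row `x ∈ □` and every `f` supported in `□`, with `u_k = actualBgU1 hd2 k e v`:
`‖(G_k(□,u_k)f)(x) − (G_k(T,u_k)f)(x)‖ ≤ (L^kε)²·c₃e^{−δ₃D/L^k}e^{−δ₃(D_b + D_f)/L^k}·F`.
[cite: Balaban1983RegularityDecay, Theorem p.573 (1.11)–(1.12)] [cite: BalabanImbrieJaffe1985, (7.3.1) p.326, (4.5.4) p.313] -/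
theorem close112_actualBg_cube_torus_allRows (d ℓ : ℕ) (hd1 : 1 ≤ d) (hd3 : d + 1 ≤ 3) (hℓ : 1 ≤ ℓ) (hodd : Odd (ℓ + 1)) {a : ℝ}
    (ha : 0 < a) (pexp : ℝ) :
    ∃ c₁ c₃ δ₃ : ℝ, 0 < c₁ ∧ 0 < c₃ ∧ 0 < δ₃ ∧ ∀ (P : Params) (hPd : P.d = d + 1), P.L = ℓ + 1 →
      ∀ (hd2 : 2 ≤ P.d) (k : ℕ), 1 ≤ k → k ≤ P.K → 2 * (P.L ^ k - 1) + 4 < P.sitesPerDir 0 →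
      ∀ (e : ℝ), 0 < e → e ≤ 1 → e * (1 + Real.log e⁻¹) ^ pexp ≤ c₁ →
      ∀ (v : U1Field P k), (∀ q : Balaban1983to89.Plaq P k, ‖((plaq v q : Circle) : ℂ) - 1‖ ≤ e * (1 + Real.log e⁻¹) ^ pexp) →
      ∀ (c M : Fin (d + 1) → ℕ), (∀ i, 1 ≤ M i) → (∀ i, c i * P.L ^ k + P.L ^ k * M i ≤ P.sitesPerDir 0) →
        (∀ i, P.L ^ k * M i < P.sitesPerDir 0) →
      ∀ x ∈ cubeT hPd (P.L ^ k) c (fun i => P.L ^ k * M i),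
      ∀ (f : Balaban1983to89.Site P 0 → ℂ) (F D Db Df : ℝ), (∀ y, ‖f y‖ ≤ F) →
        (∀ y, y ∉ cubeT hPd (P.L ^ k) c (fun i => P.L ^ k * M i) → f y = 0) →
        0 ≤ D → (∀ y, f y ≠ 0 → D ≤ B5Ineq137Torus.T P 0 x y) → 0 ≤ Db →
        (∀ w, w ∉ cubeT hPd (P.L ^ k) c (fun i => P.L ^ k * M i) → Db ≤ B5Ineq137Torus.T P 0 x w) →
        0 ≤ Df → (∀ y, f y ≠ 0 → ∀ w, w ∉ cubeT hPd (P.L ^ k) c (fun i => P.L ^ k * M i) → Df ≤ B5Ineq137Torus.T P 0 y w) →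
        ‖(gBox (B1RG242Torus.α P a k * (P.L : ℝ) ^ (k * P.d)) P.eps⁻¹ (actualBgU1 hd2 k e v) k
              (cubeT hPd (P.L ^ k) c fun i => P.L ^ k * M i) *ᵥ f) x -
            (gBox (B1RG242Torus.α P a k * (P.L : ℝ) ^ (k * P.d)) P.eps⁻¹ (actualBgU1 hd2 k e v) k univ *ᵥ f) x‖ ≤
          P.spacing k ^ 2 * (c₃ * Real.exp (-(δ₃ * (((P.L : ℝ) ^ k)⁻¹ * D))) *
            Real.exp (-(δ₃ * (((P.L : ℝ) ^ k)⁻¹ * (Db + Df)))) * F) := by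
  obtain ⟨K, hK1, HK⟩ := smallPlaquette_actualBg (d := d + 1) (L := ℓ + 1) (by omega) pexp
  obtain ⟨c₃, δ₃, hc₃, hδ₃, HC⟩ := close112_smallPlaquette_cube_torus_allRows d ℓ hd1 hd3 hℓ hodd ha
  refine ⟨1 / (23 * ((d : ℝ) + 1) ^ 2 * K), c₃, δ₃, by positivity, hc₃, hδ₃, ?_⟩
  intro P hPd hPL hd2 k hk1 hkK hbig e he he1 hsm v hv c M hM hfit hN x hx f F D Db Df hF hfB hD hsD hDb hsDb hDf hsDf
  rw [← cast_d_eq hPd] at hsm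
  obtain ⟨hθ0, hplaq, -, -, -, -, hτ⟩ := HK P hPd hPL hd2 k hk1 (hkK.trans (Nat.le_add_left _ _)) e he he1 hsm v hv
  exact HC P hPd hPL k hk1 hkK hbig (actualBgU1 hd2 k e v) _ hθ0 hplaq hτ c M hM hfit hN x hx f F D Db Df hF hfB hD hsD hDb hsDb
    hDf hsDf

/-- **[Balaban1983RegularityDecay] (1.11)–(1.12), COVARIANT-DERIVATIVE MEMBER, FOR A TORUS CUBE AGAINST THE WHOLE TORUS AT THE ACTUAL
BACKGROUND `u_k(e_k, v)` UNDER THE PRINTED (7.3.1), AT EVERY ROW WITH `dist_∞(x, T ∖ □) ≥ L^k`** (gen 29's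
`close112_smallPlaquette_cube_torus_deriv_ballRows` ∘ p34's `smallPlaquette_actualBg`): same data as `close112_actualBg_cube_torus_allRows`,
rows `x ∈ □` with `L^k ≤ T(x, w)` for every `w ∉ □`, every `μ`:
`‖covD ε⁻¹ u_k (G_k(□,u_k)f) ⟨x,μ⟩ − covD ε⁻¹ u_k (G_k(T,u_k)f) ⟨x,μ⟩‖ ≤ (L^kε)·c₃e^{−δ₃D/L^k}e^{−δ₃(D_b + D_f)/L^k}·F`.
[cite: Balaban1983RegularityDecay, Theorem p.573 (1.10)–(1.12)] [cite: BalabanImbrieJaffe1985, (7.3.1) p.326, (4.5.4) p.313] -/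
theorem close112_actualBg_cube_torus_deriv_ballRows (d ℓ : ℕ) (hd1 : 1 ≤ d) (hd3 : d + 1 ≤ 3) (hℓ : 1 ≤ ℓ) (hodd : Odd (ℓ + 1))
    {a : ℝ} (ha : 0 < a) (pexp : ℝ) :
    ∃ c₁ c₃ δ₃ : ℝ, 0 < c₁ ∧ 0 < c₃ ∧ 0 < δ₃ ∧ ∀ (P : Params) (hPd : P.d = d + 1), P.L = ℓ + 1 →
      ∀ (hd2 : 2 ≤ P.d) (k : ℕ), 1 ≤ k → k ≤ P.K → 2 * (P.L ^ k - 1) + 4 < P.sitesPerDir 0 →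
      ∀ (e : ℝ), 0 < e → e ≤ 1 → e * (1 + Real.log e⁻¹) ^ pexp ≤ c₁ →
      ∀ (v : U1Field P k), (∀ q : Balaban1983to89.Plaq P k, ‖((plaq v q : Circle) : ℂ) - 1‖ ≤ e * (1 + Real.log e⁻¹) ^ pexp) →
      ∀ (c M : Fin (d + 1) → ℕ), (∀ i, 1 ≤ M i) → (∀ i, c i * P.L ^ k + P.L ^ k * M i ≤ P.sitesPerDir 0) →
        (∀ i, P.L ^ k * M i < P.sitesPerDir 0) →
      ∀ x ∈ cubeT hPd (P.L ^ k) c (fun i => P.L ^ k * M i),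
        (∀ w, w ∉ cubeT hPd (P.L ^ k) c (fun i => P.L ^ k * M i) → (P.L : ℝ) ^ k ≤ B5Ineq137Torus.T P 0 x w) →
      ∀ (f : Balaban1983to89.Site P 0 → ℂ) (F D Db Df : ℝ), (∀ y, ‖f y‖ ≤ F) →
        (∀ y, y ∉ cubeT hPd (P.L ^ k) c (fun i => P.L ^ k * M i) → f y = 0) →
        0 ≤ D → (∀ y, f y ≠ 0 → D ≤ B5Ineq137Torus.T P 0 x y) → 0 ≤ Db →
        (∀ w, w ∉ cubeT hPd (P.L ^ k) c (fun i => P.L ^ k * M i) → Db ≤ B5Ineq137Torus.T P 0 x w) →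
        0 ≤ Df → (∀ y, f y ≠ 0 → ∀ w, w ∉ cubeT hPd (P.L ^ k) c (fun i => P.L ^ k * M i) → Df ≤ B5Ineq137Torus.T P 0 y w) →
        ∀ (μ : Fin P.d),
        ‖covD P.eps⁻¹ (cfg (actualBgU1 hd2 k e v))
              (gBox (B1RG242Torus.α P a k * (P.L : ℝ) ^ (k * P.d)) P.eps⁻¹ (actualBgU1 hd2 k e v) k
                (cubeT hPd (P.L ^ k) c fun i => P.L ^ k * M i) *ᵥ f) ⟨x, μ⟩ -
            covD P.eps⁻¹ (cfg (actualBgU1 hd2 k e v))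
              (gBox (B1RG242Torus.α P a k * (P.L : ℝ) ^ (k * P.d)) P.eps⁻¹ (actualBgU1 hd2 k e v) k univ *ᵥ f) ⟨x, μ⟩‖ ≤
          P.spacing k * (c₃ * Real.exp (-(δ₃ * (((P.L : ℝ) ^ k)⁻¹ * D))) *
            Real.exp (-(δ₃ * (((P.L : ℝ) ^ k)⁻¹ * (Db + Df)))) * F) := by
  obtain ⟨K, hK1, HK⟩ := smallPlaquette_actualBg (d := d + 1) (L := ℓ + 1) (by omega) pexp
  obtain ⟨c₃, δ₃, hc₃, hδ₃, HC⟩ := close112_smallPlaquette_cube_torus_deriv_ballRows d ℓ hd1 hd3 hℓ hodd ha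
  refine ⟨1 / (23 * ((d : ℝ) + 1) ^ 2 * K), c₃, δ₃, by positivity, hc₃, hδ₃, ?_⟩
  intro P hPd hPL hd2 k hk1 hkK hbig e he he1 hsm v hv c M hM hfit hN x hx hrow f F D Db Df hF hfB hD hsD hDb hsDb hDf hsDf μ
  rw [← cast_d_eq hPd] at hsm
  obtain ⟨hθ0, hplaq, -, -, -, -, hτ⟩ := HK P hPd hPL hd2 k hk1 (hkK.trans (Nat.le_add_left _ _)) e he he1 hsm v hv
  exact HC P hPd hPL k hk1 hkK hbig (actualBgU1 hd2 k e v) _ hθ0 hplaq hτ c M hM hfit hN x hx hrow f F D Db Df hF hfB hD hsD hDb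
    hsDb hDf hsDf μ

/-! ## §4 The Hölder (order `1+α`) member for nested block unions at the actual background (p27's member BY NAME) -/

/-- **[Balaban1983RegularityDecay] (1.9), (1.11)–(1.12), HÖLDER MEMBER (ORDER `1+α`), FOR GENERAL NESTED `k`-BLOCK UNIONS `□ ⊆ Ω` AT THE
ACTUAL BACKGROUND `u_k(e_k, v)` UNDER THE PRINTED (7.3.1)** (p27 g37's `BIJ88NeumannPropagatorSmallFieldCloseHolder.closeHolder112_smallField_of_inputs110`
(p356227) with its four (H1.10″) inputs discharged by §1's `inputs110_actualBg_region`; included here at p27 g37's offer 2026-08-23T08:45:25Z so that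
the `u_k` table sits in one file): for `1 ≤ d`, `d + 1 ≤ 3`, `ℓ ≥ 1` with `ℓ + 1` odd, `a > 0`, `𝓅`, `0 ≤ α < 1` there are `c₁, c₃, δ₃ > 0`
such that for every volume (`P.d = d + 1`, `P.L = ℓ + 1`), every `1 ≤ k ≤ K` with `2(L^k − 1) + 4 < |T|`, every `0 < e ≤ 1` with
`e𝓅(e) ≤ c₁`, every `v` with (7.3.1), all nested `k`-block unions `□ ⊆ Ω`, every pair of distinct rows `x₀ ≠ x₁` of `□` with
`dist_∞(x_i, T ∖ □) ≥ 17L^k`, every `μ` and every `f` supported in `□`, with `u_k = actualBgU1 hd2 k e v`,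
`w = G_k(□,u_k)f − G_k(Ω,u_k)f`, `Γ = stairHol u_k x₀ x₁`:
`(L^k/T(x₀,x₁))^α·‖U(Γ)(D_{u_k}w)(⟨x₁,μ⟩) − (D_{u_k}w)(⟨x₀,μ⟩)‖ ≤ (L^kε)·c₃e^{−δ₃D/L^k}e^{−δ₃(D_b+D_f)/L^k}·F`.
[cite: Balaban1983RegularityDecay, Theorem p.573 (1.9), (1.11)–(1.12)] [cite: BalabanImbrieJaffe1985, (7.3.1) p.326, (4.5.4) p.313] -/
theorem closeHolder112_actualBg_region (d ℓ : ℕ) (hd1 : 1 ≤ d) (hd3 : d + 1 ≤ 3) (hℓ : 1 ≤ ℓ) (hodd : Odd (ℓ + 1)) {a : ℝ}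
    (ha : 0 < a) (pexp : ℝ) {α : ℝ} (hα0 : 0 ≤ α) (hα1 : α < 1) :
    ∃ c₁ c₃ δ₃ : ℝ, 0 < c₁ ∧ 0 < c₃ ∧ 0 < δ₃ ∧ ∀ (P : Params) (hPd : P.d = d + 1), P.L = ℓ + 1 →
      ∀ (hd2 : 2 ≤ P.d) (k : ℕ), 1 ≤ k → k ≤ P.K → 2 * (P.L ^ k - 1) + 4 < P.sitesPerDir 0 →
      ∀ (e : ℝ), 0 < e → e ≤ 1 → e * (1 + Real.log e⁻¹) ^ pexp ≤ c₁ →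
      ∀ (v : U1Field P k), (∀ q : Balaban1983to89.Plaq P k, ‖((plaq v q : Circle) : ℂ) - 1‖ ≤ e * (1 + Real.log e⁻¹) ^ pexp) →
      ∀ (B Ω : Finset (Balaban1983to89.Site P 0)), IsBlockUnion k B → IsBlockUnion k Ω → B ⊆ Ω →
      ∀ (x₀ x₁ : Balaban1983to89.Site P 0) (μ : Fin P.d), x₀ ≠ x₁ → x₀ ∈ B → x₁ ∈ B →
        (∀ w, w ∉ B → 17 * (P.L : ℝ) ^ k ≤ B5Ineq137Torus.T P 0 x₀ w) →
        (∀ w, w ∉ B → 17 * (P.L : ℝ) ^ k ≤ B5Ineq137Torus.T P 0 x₁ w) →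
      ∀ (f : Balaban1983to89.Site P 0 → ℂ) (F D Db Df : ℝ), (∀ y, ‖f y‖ ≤ F) → (∀ y, y ∉ B → f y = 0) →
        0 ≤ D → (∀ y, f y ≠ 0 → D ≤ B5Ineq137Torus.T P 0 x₀ y) → (∀ y, f y ≠ 0 → D ≤ B5Ineq137Torus.T P 0 x₁ y) →
        0 ≤ Db → (∀ w, w ∉ B → Db ≤ B5Ineq137Torus.T P 0 x₀ w) → (∀ w, w ∉ B → Db ≤ B5Ineq137Torus.T P 0 x₁ w) →
        0 ≤ Df → (∀ y, f y ≠ 0 → ∀ w, w ∉ B → Df ≤ B5Ineq137Torus.T P 0 y w) →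
        ((P.L : ℝ) ^ k / B5Ineq137Torus.T P 0 x₀ x₁) ^ α *
            ‖stairHol (actualBgU1 hd2 k e v) x₀ x₁ *
                covD P.eps⁻¹ (cfg (actualBgU1 hd2 k e v))
                  (gBox (B1RG242Torus.α P a k * (P.L : ℝ) ^ (k * P.d)) P.eps⁻¹ (actualBgU1 hd2 k e v) k B *ᵥ f -
                    gBox (B1RG242Torus.α P a k * (P.L : ℝ) ^ (k * P.d)) P.eps⁻¹ (actualBgU1 hd2 k e v) k Ω *ᵥ f) ⟨x₁, μ⟩ -
              covD P.eps⁻¹ (cfg (actualBgU1 hd2 k e v))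
                  (gBox (B1RG242Torus.α P a k * (P.L : ℝ) ^ (k * P.d)) P.eps⁻¹ (actualBgU1 hd2 k e v) k B *ᵥ f -
                    gBox (B1RG242Torus.α P a k * (P.L : ℝ) ^ (k * P.d)) P.eps⁻¹ (actualBgU1 hd2 k e v) k Ω *ᵥ f) ⟨x₀, μ⟩‖
          ≤ P.spacing k * (c₃ * Real.exp (-(δ₃ * (((P.L : ℝ) ^ k)⁻¹ * D))) *
              Real.exp (-(δ₃ * (((P.L : ℝ) ^ k)⁻¹ * (Db + Df)))) * F) := by
  obtain ⟨c₁, K, c₀, δ₀, hc₁, -, hc₀, hδ₀, HI⟩ := inputs110_actualBg_region d ℓ hd1 hd3 hℓ hodd ha pexp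
  obtain ⟨c₃, δ₃, hc₃, hδ₃, H⟩ :=
    closeHolder112_smallField_of_inputs110 (d + 1) (ℓ + 1) (by omega) hd3 ⟨hodd, by omega⟩ ha hc₀ hδ₀ hα0 hα1
  refine ⟨c₁, c₃, δ₃, hc₁, hc₃, hδ₃, ?_⟩
  intro P hPd hPL hd2 k hk1 hkK hbig e he he1 hsm v hv B Ω hB hΩ hsub x₀ x₁ μ hne hx₀ hx₁ hdeep₀ hdeep₁ f F D Db Df hF hfB hD hsD₀
    hsD₁ hDb hsDb₀ hsDb₁ hDf hsDf
  obtain ⟨-, hplaq, -, hsm1, hGB, hGΩ, hDB, hDΩ⟩ := HI P hPd hPL hd2 k hk1 hkK hbig e he he1 hsm v hv B Ω hB hΩ hsub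
  exact H P hPd hPL k hk1 hkK (actualBgU1 hd2 k e v) _ hplaq hsm1 B Ω hB hΩ hsub hGB hGΩ hDB hDΩ x₀ x₁ μ hne hx₀ hx₁ hdeep₀ hdeep₁
    f F D Db Df hF hfB hD hsD₀ hsD₁ hDb hsDb₀ hsDb₁ hDf hsDf

/-- **§4 IN THE (H1.12)-HÖLDER INPUT BINDER SHAPE AT THE ACTUAL BACKGROUND** (p27 g37's `closeHolder112_smallField_input110` ∘ §1's
`inputs110_actualBg_region`): direction first, `x₁ ≠ x₀`, the deep rows as the ball conditions `T(x_i,y) ≤ 17L^k → y ∈ □`, no sign conditions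
on `D, D_b, D_f`, transport `stairHol u_k x₀ x₁` — the small-field provider, at `u_k`, for a generic order-`(1+θ)` member of
[BalabanImbrieJaffe1988] (2.31) read through r18's `input112_holder_regular_univ` binder.
[cite: Balaban1983RegularityDecay, Theorem p.573 (1.9), (1.11)–(1.12)] [cite: BalabanImbrieJaffe1985, (7.3.1) p.326]
[cite: BalabanImbrieJaffe1988, p.263, (2.31)] -/
theorem closeHolder112_actualBg_region_input (d ℓ : ℕ) (hd1 : 1 ≤ d) (hd3 : d + 1 ≤ 3) (hℓ : 1 ≤ ℓ) (hodd : Odd (ℓ + 1)) {a : ℝ}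
    (ha : 0 < a) (pexp : ℝ) {α : ℝ} (hα0 : 0 ≤ α) (hα1 : α < 1) :
    ∃ c₁ c₃ δ₃ : ℝ, 0 < c₁ ∧ 0 < c₃ ∧ 0 < δ₃ ∧ ∀ (P : Params) (hPd : P.d = d + 1), P.L = ℓ + 1 →
      ∀ (hd2 : 2 ≤ P.d) (k : ℕ), 1 ≤ k → k ≤ P.K → 2 * (P.L ^ k - 1) + 4 < P.sitesPerDir 0 →
      ∀ (e : ℝ), 0 < e → e ≤ 1 → e * (1 + Real.log e⁻¹) ^ pexp ≤ c₁ →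
      ∀ (v : U1Field P k), (∀ q : Balaban1983to89.Plaq P k, ‖((plaq v q : Circle) : ℂ) - 1‖ ≤ e * (1 + Real.log e⁻¹) ^ pexp) →
      ∀ (B Ω : Finset (Balaban1983to89.Site P 0)), IsBlockUnion k B → IsBlockUnion k Ω → B ⊆ Ω →
      ∀ (μ : Fin P.d) (x₀ x₁ : Balaban1983to89.Site P 0), x₁ ≠ x₀ →
        (∀ y, B5Ineq137Torus.T P 0 x₀ y ≤ 17 * (P.L : ℝ) ^ k → y ∈ B) →
        (∀ y, B5Ineq137Torus.T P 0 x₁ y ≤ 17 * (P.L : ℝ) ^ k → y ∈ B) →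
      ∀ (f : Balaban1983to89.Site P 0 → ℂ) (F D Db Df : ℝ), (∀ y, ‖f y‖ ≤ F) → (∀ y, y ∉ B → f y = 0) →
        (∀ y, f y ≠ 0 → D ≤ B5Ineq137Torus.T P 0 x₀ y) → (∀ y, f y ≠ 0 → D ≤ B5Ineq137Torus.T P 0 x₁ y) →
        (∀ w, w ∉ B → Db ≤ B5Ineq137Torus.T P 0 x₀ w) → (∀ w, w ∉ B → Db ≤ B5Ineq137Torus.T P 0 x₁ w) →
        (∀ y, f y ≠ 0 → ∀ w, w ∉ B → Df ≤ B5Ineq137Torus.T P 0 y w) →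
        ((P.L : ℝ) ^ k / B5Ineq137Torus.T P 0 x₀ x₁) ^ α *
            ‖stairHol (actualBgU1 hd2 k e v) x₀ x₁ *
                covD P.eps⁻¹ (cfg (actualBgU1 hd2 k e v))
                  (gBox (B1RG242Torus.α P a k * (P.L : ℝ) ^ (k * P.d)) P.eps⁻¹ (actualBgU1 hd2 k e v) k B *ᵥ f -
                    gBox (B1RG242Torus.α P a k * (P.L : ℝ) ^ (k * P.d)) P.eps⁻¹ (actualBgU1 hd2 k e v) k Ω *ᵥ f) ⟨x₁, μ⟩ -
              covD P.eps⁻¹ (cfg (actualBgU1 hd2 k e v))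
                  (gBox (B1RG242Torus.α P a k * (P.L : ℝ) ^ (k * P.d)) P.eps⁻¹ (actualBgU1 hd2 k e v) k B *ᵥ f -
                    gBox (B1RG242Torus.α P a k * (P.L : ℝ) ^ (k * P.d)) P.eps⁻¹ (actualBgU1 hd2 k e v) k Ω *ᵥ f) ⟨x₀, μ⟩‖
          ≤ P.spacing k * (c₃ * Real.exp (-(δ₃ * (((P.L : ℝ) ^ k)⁻¹ * D))) *
              Real.exp (-(δ₃ * (((P.L : ℝ) ^ k)⁻¹ * (Db + Df)))) * F) := by
  obtain ⟨c₁, K, c₀, δ₀, hc₁, -, hc₀, hδ₀, HI⟩ := inputs110_actualBg_region d ℓ hd1 hd3 hℓ hodd ha pexp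
  obtain ⟨c₃, δ₃, hc₃, hδ₃, H⟩ :=
    closeHolder112_smallField_input110 (d + 1) (ℓ + 1) (by omega) hd3 ⟨hodd, by omega⟩ ha hc₀ hδ₀ hα0 hα1
  refine ⟨c₁, c₃, δ₃, hc₁, hc₃, hδ₃, ?_⟩
  intro P hPd hPL hd2 k hk1 hkK hbig e he he1 hsm v hv B Ω hB hΩ hsub μ x₀ x₁ hne hball₀ hball₁ f F D Db Df hF hfB hsD₀ hsD₁ hsDb₀
    hsDb₁ hsDf
  obtain ⟨-, hplaq, -, hsm1, hGB, hGΩ, hDB, hDΩ⟩ := HI P hPd hPL hd2 k hk1 hkK hbig e he he1 hsm v hv B Ω hB hΩ hsub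
  exact H P hPd hPL k hk1 hkK (actualBgU1 hd2 k e v) _ hplaq hsm1 B Ω hB hΩ hsub hGB hGΩ hDB hDΩ μ x₀ x₁ hne hball₀ hball₁ f F D Db Df
    hF hfB hsD₀ hsD₁ hsDb₀ hsDb₁ hsDf

end

end Literature.MathematicalPhysics.QuantumFieldTheory.BalabanImbrieJaffe1984to88.BIJ88NeumannPropagatorActualBackgroundRegion
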